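import Mathlib
import Literature.Probability.LatticeModels.ClusterExpansion
import HarnessLib

/-!
# `StaticScoreResponse` (support item stmt-AtomisticToContinuum-12269): an analytic logarithm of
# polymer partition functions under the Kotecký–Preiss condition

For an abstract polymer gas (`Literature.Probability.LatticeModels.polymerPartitionFunction`, with
a reflexive symmetric incompatibility `inc`) whose activities `w s γ` depend holomorphically on a
complex parameter `s ∈ U` and satisfy the finite-volume Kotecký–Preiss condition
`IsKPVolume inc (w s) a Λ` for every `s ∈ U`, we construct a function `h` holomorphic on `U` with

* `exp (h s) = Z(Λ; w s)`,
* `‖h s‖ ≤ 2 ∑_{γ ∈ Λ} ‖w s γ‖ e^{a γ}` (so `‖h‖ = O(|Λ|)`-type bounds follow from one-polymer sums),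
* `h s` real whenever all activities `w s γ`, `γ ∈ Λ`, are real.

Construction (`exists_differentiableOn_log_polymerPartitionFunction`): add the polymers of `Λ` one
at a time and sum the principal logarithms of the one-polymer ratios `Z(Λ' ∪ {γ})/Z(Λ')`, which by
the Kotecký–Preiss/Dobrushin ratio bound (`polymerPartitionFunction_kp_bounds`:
`‖Z(Λ' ∪ {γ})/Z(Λ') - 1‖ ≤ x_γ e^{-x_γ} ≤ 1/e`) stay in the disc `‖ρ - 1‖ ≤ 1/2` inside the slit
plane, where `log` is holomorphic and `‖log ρ‖ ≤ (3/2)‖ρ - 1‖`.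

This is the input for Cauchy estimates on cumulants of the canonical hard-sphere gas (uniform in
the number of particles) in the proof of `StaticScoreResponse`. Everything is folklore
(Kotecký–Preiss 1986; Dobrushin 1996); no definitions, no named facts.
-/

noncomputable section

namespace Summit.AtomisticToContinuum.HydrodynamicLimit.Theorems

open Finset Complex Literature.Probability.LatticeModels

variable {P : Type*} [DecidableEq P] {inc : P → P → Prop} [DecidableRel inc]

/-- The polymer partition function depends holomorphically on holomorphic activities (it is a
polynomial in the activities). [folklore] -/
theorem differentiableOn_polymerPartitionFunction {U : Set ℂ} {w : ℂ → P → ℂ} {Λ Λ' : Finset P}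
    (hΛ' : Λ' ⊆ Λ) (hw : ∀ γ ∈ Λ, DifferentiableOn ℂ (fun s => w s γ) U) :
    DifferentiableOn ℂ (fun s => polymerPartitionFunction inc (w s) Λ') U := by
  unfold polymerPartitionFunction
  refine DifferentiableOn.fun_sum fun X hX => ?_
  split_ifs with hc
  · exact DifferentiableOn.fun_finsetProd fun γ hγ => hw γ (hΛ' (Finset.mem_powerset.1 hX hγ))
  · exact differentiableOn_const 0

/-- With real activities the polymer partition function is real. [folklore] -/
theorem im_polymerPartitionFunction_eq_zero {w : P → ℂ} {Λ' : Finset P}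
    (hw : ∀ γ ∈ Λ', (w γ).im = 0) : (polymerPartitionFunction inc w Λ').im = 0 := by
  have hcongr : polymerPartitionFunction inc w Λ' =
      polymerPartitionFunction inc (fun γ => (((w γ).re : ℝ) : ℂ)) Λ' :=
    polymerPartitionFunction_congr fun γ hγ => Complex.ext (by simp) (by simp [hw γ hγ])
  rw [hcongr]
  unfold polymerPartitionFunction
  rw [Complex.im_sum]
  refine Finset.sum_eq_zero fun X _ => ?_
  split_ifs
  · rw [← Complex.ofReal_prod, Complex.ofReal_im]
  · simp

/-- `x e^{-x} ≤ 1/2` (indeed `≤ 1/e`). [folklore] -/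
theorem mul_exp_neg_le_half (x : ℝ) : x * Real.exp (-x) ≤ 1 / 2 := by
  have h1 : x ≤ Real.exp (x - 1) := by
    have := Real.add_one_le_exp (x - 1)
    linarith
  have h2 : (2 : ℝ) ≤ Real.exp 1 := by
    have := Real.add_one_le_exp (1 : ℝ)
    norm_num at this
    linarith
  have h3 : x * Real.exp (-x) ≤ Real.exp (-1) := by
    calc x * Real.exp (-x) ≤ Real.exp (x - 1) * Real.exp (-x) :=
          mul_le_mul_of_nonneg_right h1 (Real.exp_nonneg _)
      _ = Real.exp (-1) := by rw [← Real.exp_add]; ring_nf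
  have h4 : Real.exp (-1) ≤ 1 / 2 := by
    rw [Real.exp_neg, inv_le_comm₀ (Real.exp_pos 1) (by norm_num)]
    norm_num
    exact h2
  exact h3.trans h4

/-- A complex number within distance `< 1` of `1` has positive real part, hence lies in the slit
plane. [folklore] -/
theorem re_pos_of_norm_sub_one_lt {z : ℂ} (hz : ‖z - 1‖ < 1) : 0 < z.re := by
  have h := Complex.abs_re_le_norm (z - 1)
  rw [Complex.sub_re, Complex.one_re] at h
  have := (abs_lt.1 (h.trans_lt hz)).1
  linarith

/-- **Holomorphic logarithm of the polymer partition function under Kotecký–Preiss.** If the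
activities `w s γ` (`γ ∈ Λ`) are holomorphic in `s ∈ U` and `Λ` is a KP volume for `w s` for every
`s ∈ U`, then for every sub-volume `Λ' ⊆ Λ` there is `h` holomorphic on `U` with `exp (h s) = Z(Λ'; w s)`,
`‖h s‖ ≤ 2 ∑_{γ ∈ Λ'} ‖w s γ‖ e^{a γ}`, and `h s` real when the activities on `Λ'` are real (sum of
the principal logarithms of the one-polymer ratios, which stay in `‖ρ - 1‖ ≤ 1/2` by the
Kotecký–Preiss ratio bound). [folklore] -/
theorem exists_differentiableOn_log_polymerPartitionFunction_subset [Std.Refl inc] [Std.Symm inc]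
    {U : Set ℂ} {w : ℂ → P → ℂ} {a : P → ℝ} {Λ : Finset P}
    (hw : ∀ γ ∈ Λ, DifferentiableOn ℂ (fun s => w s γ) U)
    (hKP : ∀ s ∈ U, IsKPVolume inc (w s) a Λ) :
    ∀ Λ' ⊆ Λ, ∃ h : ℂ → ℂ, DifferentiableOn ℂ h U ∧
      (∀ s ∈ U, Complex.exp (h s) = polymerPartitionFunction inc (w s) Λ') ∧
      (∀ s ∈ U, ‖h s‖ ≤ 2 * ∑ γ ∈ Λ', kpTerm (w s) a γ) ∧
      (∀ s ∈ U, (∀ γ ∈ Λ', (w s γ).im = 0) → (h s).im = 0) := by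
  intro Λ' hΛ'
  induction Λ' using Finset.induction_on with
  | empty =>
    refine ⟨fun _ => 0, differentiableOn_const 0, fun s _ => ?_, fun s _ => ?_, fun s _ _ => ?_⟩
    · simp
    · simp
    · simp
  | insert γ Λ' hγ ih =>
    have hΛ'Λ : Λ' ⊆ Λ := (Finset.subset_insert γ Λ').trans hΛ'
    obtain ⟨h, hh, hexp, hnorm, hreal⟩ := ih hΛ'Λ
    -- the one-polymer ratio
    set ρ : ℂ → ℂ := fun s => polymerPartitionFunction inc (w s) (insert γ Λ') /
      polymerPartitionFunction inc (w s) Λ' with hρ_def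
    -- facts from the Kotecký–Preiss bounds
    have hfacts : ∀ s ∈ U, polymerPartitionFunction inc (w s) (insert γ Λ') ≠ 0 ∧
        polymerPartitionFunction inc (w s) Λ' ≠ 0 ∧
        ‖ρ s - 1‖ ≤ kpTerm (w s) a γ * Real.exp (-kpTerm (w s) a γ) := by
      intro s hs
      have hb := polymerPartitionFunction_kp_bounds (inc := inc) (hKP s hs)
      obtain ⟨hne, hrat⟩ := hb (insert γ Λ') hΛ'
      obtain ⟨hne', -⟩ := hb Λ' hΛ'Λ
      have h3 := (hrat γ (Finset.mem_insert_self γ Λ')).2.2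
      rw [Finset.erase_insert hγ] at h3
      exact ⟨hne, hne', h3⟩
    have hρ1 : ∀ s ∈ U, ‖ρ s - 1‖ ≤ 1 / 2 := fun s hs =>
      (hfacts s hs).2.2.trans (mul_exp_neg_le_half _)
    have hρre : ∀ s ∈ U, 0 < (ρ s).re := fun s hs =>
      re_pos_of_norm_sub_one_lt ((hρ1 s hs).trans_lt (by norm_num))
    have hρ0 : ∀ s ∈ U, ρ s ≠ 0 := fun s hs h0 => by
      have := hρre s hs; rw [h0] at this; simp at this
    refine ⟨fun s => h s + Complex.log (ρ s), ?_, fun s hs => ?_, fun s hs => ?_, fun s hs hws => ?_⟩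
    · -- holomorphy
      refine hh.add (DifferentiableOn.clog ?_ fun s hs => Or.inl (hρre s hs))
      exact (differentiableOn_polymerPartitionFunction hΛ' hw).div
        (differentiableOn_polymerPartitionFunction hΛ'Λ hw) fun s hs => (hfacts s hs).2.1
    · -- exponential
      rw [Complex.exp_add, hexp s hs, Complex.exp_log (hρ0 s hs), hρ_def]
      simp only
      rw [mul_div_cancel₀ _ (hfacts s hs).2.1]
    · -- norm bound
      rw [Finset.sum_insert hγ, mul_add]
      have hlog : ‖Complex.log (ρ s)‖ ≤ 2 * kpTerm (w s) a γ := by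
        have h1 : ‖Complex.log (1 + (ρ s - 1))‖ ≤ (3 / 2) * ‖ρ s - 1‖ :=
          Complex.norm_log_one_add_half_le_self (hρ1 s hs)
        rw [add_sub_cancel] at h1
        have h2 : ‖ρ s - 1‖ ≤ kpTerm (w s) a γ := by
          refine (hfacts s hs).2.2.trans ?_
          have hx := kpTerm_nonneg (w s) a γ
          have : Real.exp (-kpTerm (w s) a γ) ≤ 1 := Real.exp_le_one_iff.2 (by linarith)
          nlinarith
        nlinarith [norm_nonneg (ρ s - 1)]
      calc ‖h s + Complex.log (ρ s)‖ ≤ ‖h s‖ + ‖Complex.log (ρ s)‖ := norm_add_le _ _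
        _ ≤ 2 * ∑ γ ∈ Λ', kpTerm (w s) a γ + 2 * kpTerm (w s) a γ := add_le_add (hnorm s hs) hlog
        _ = 2 * kpTerm (w s) a γ + 2 * ∑ γ ∈ Λ', kpTerm (w s) a γ := add_comm _ _
    · -- realness
      have hΛ'real : ∀ γ' ∈ Λ', (w s γ').im = 0 := fun γ' hγ' => hws γ' (Finset.mem_insert_of_mem hγ')
      have him1 : (polymerPartitionFunction inc (w s) (insert γ Λ')).im = 0 :=
        im_polymerPartitionFunction_eq_zero hws
      have him0 : (polymerPartitionFunction inc (w s) Λ').im = 0 :=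
        im_polymerPartitionFunction_eq_zero hΛ'real
      -- the ratio is a positive real
      set q : ℝ := (polymerPartitionFunction inc (w s) (insert γ Λ')).re /
        (polymerPartitionFunction inc (w s) Λ').re with hq_def
      have hρq : ρ s = (q : ℂ) := by
        have e1 : polymerPartitionFunction inc (w s) (insert γ Λ') =
            (((polymerPartitionFunction inc (w s) (insert γ Λ')).re : ℝ) : ℂ) :=
          Complex.ext (by simp) (by simp [him1])
        have e0 : polymerPartitionFunction inc (w s) Λ' =
            (((polymerPartitionFunction inc (w s) Λ').re : ℝ) : ℂ) :=
          Complex.ext (by simp) (by simp [him0])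
        rw [hρ_def]
        simp only
        rw [e1, e0, ← Complex.ofReal_div]
      have hqpos : 0 < q := by
        have := hρre s hs
        rwa [hρq, Complex.ofReal_re] at this
      rw [Complex.add_im, hreal s hs hΛ'real, hρq, Complex.log_im,
        Complex.arg_ofReal_of_nonneg hqpos.le, add_zero]

/-- **Holomorphic logarithm of the polymer partition function under Kotecký–Preiss** (the volume
itself): `h` holomorphic on `U` with `exp (h s) = Z(Λ; w s)`, `‖h s‖ ≤ 2 ∑_{γ ∈ Λ} ‖w s γ‖ e^{a γ}`,
and `h s` real for real activities. [folklore] -/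
theorem exists_differentiableOn_log_polymerPartitionFunction [Std.Refl inc] [Std.Symm inc]
    {U : Set ℂ} {w : ℂ → P → ℂ} {a : P → ℝ} {Λ : Finset P}
    (hw : ∀ γ ∈ Λ, DifferentiableOn ℂ (fun s => w s γ) U)
    (hKP : ∀ s ∈ U, IsKPVolume inc (w s) a Λ) :
    ∃ h : ℂ → ℂ, DifferentiableOn ℂ h U ∧
      (∀ s ∈ U, Complex.exp (h s) = polymerPartitionFunction inc (w s) Λ) ∧
      (∀ s ∈ U, ‖h s‖ ≤ 2 * ∑ γ ∈ Λ, kpTerm (w s) a γ) ∧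
      (∀ s ∈ U, (∀ γ ∈ Λ, (w s γ).im = 0) → (h s).im = 0) :=
  exists_differentiableOn_log_polymerPartitionFunction_subset hw hKP Λ Finset.Subset.rfl

/-- A complex number with zero imaginary part whose exponential is (the coercion of) a real number
`r` has real part `Real.log r`. [folklore] -/
theorem re_eq_log_of_exp_eq_ofReal {z : ℂ} {r : ℝ} (hz : z.im = 0) (h : Complex.exp z = (r : ℂ)) :
    z.re = Real.log r := by
  have hzre : z = ((z.re : ℝ) : ℂ) := Complex.ext (by simp) (by simp [hz])
  rw [hzre, ← Complex.ofReal_exp] at h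
  have h' : Real.exp z.re = r := by exact_mod_cast h
  rw [← h', Real.log_exp]

end Summit.AtomisticToContinuum.HydrodynamicLimit.Theorems

end
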